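import Literature.MathematicalPhysics.QuantumFieldTheory.Balaban1983to89.BlockAveragingHaarAC
import Literature.MathematicalPhysics.QuantumFieldTheory.Balaban1983to89.TorusHypercubicSymmetry

/-!
# The private links of Bałaban's (0.4) block averaging: lattice combinatorics (STUB D of `SpecificationLimitAE`, part 1)

Part 1 of the lattice half of STUB D (`stub_unitDensityPosAE`) of crux `SpecificationLimitAE` (stmt-QuantumFields-22688, route
`SpecificationCompactness`, LINE 15 «cocycle_limit», planner ym-idea-5 g10); part 2 is `SpecificationCompactnessAveragingReverseAC`.
For a coarse bond `c` (direction `μ`) of [Balaban1987RG1] (0.4) (tree `BlockAveraging`) we single out the off-central loop index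
with unit transverse offset `e_ν` (`ν = τμ ≠ μ`) and trivial orderings: its open holonomy factorises as
`U⟨emb c₋, ν⟩ · U(ℓ c) · rest` with the PRIVATE fine bond `ℓ c = ⟨emb c₋ + e_ν, μ⟩` (`openHol_unit`), and §2 proves — by the
arithmetic of `BlockAveragingHaarAC` (`L ∤ 1`, `L ∤ t` for `0 < |t| < L`) — that `ℓ c` is no central crossing bond, lies on no
axis line, occurs in no other chosen loop and exactly once in its own, and that `c ↦ ℓ c` is injective.

Nothing here concerns Bałaban's estimates, the continuum limit or the mass gap; [folklore] lattice combinatorics about the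
published formula (0.4).  Width seat ym-line-sfw-p2-w2 g21 (cell ym-idea-1, free hands).
-/


set_option autoImplicit false

noncomputable section

open MeasureTheory Function
open Literature.MathematicalPhysics.QuantumFieldTheory.Balaban1983to89
open Literature.MathematicalPhysics.QuantumFieldTheory.Balaban1983to89.T4Continuum
open Literature.MathematicalPhysics.QuantumFieldTheory.Balaban1983to89.AveragingRT
open Literature.MathematicalPhysics.QuantumFieldTheory.Balaban1983to89.BlockAveraging
open Literature.MathematicalPhysics.QuantumFieldTheory.Balaban1983to89.BlockAveragingHaarAC
open Literature.MathematicalPhysics.QuantumFieldTheory.Balaban1983to89.T4ReflectionCone (holAt_congr netDisp_replicate)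

namespace Summit.QuantumFields.YangMills.Theorems.AveragingPrivateLinks

/-! ## §1 The chosen loop: unit transverse offset, trivial orderings -/

section Words

variable {P : Params} {j : ℕ}

/-- Coordinates of a shifted site, integer form. [folklore] -/
theorem shift_apply_int (x : Site P j) (μ κ : Fin P.d) :
    x.shift μ κ = x κ + (((if κ = μ then (1 : ℤ) else 0 : ℤ)) : ZMod (P.sitesPerDir j)) := by
  rw [Site.shift_apply]
  by_cases h : κ = μ
  · subst h; simp
  · simp [h]

/-- The shifted coordinate itself, integer form. [folklore] -/
theorem shift_apply_int_pos (x : Site P j) (μ : Fin P.d) :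
    x.shift μ μ = x μ + ((1 : ℤ) : ZMod (P.sitesPerDir j)) := by
  rw [shift_apply_int, if_pos rfl]

/-- Coordinates of an un-shifted site, integer form. [folklore] -/
theorem unshift_apply_int (x : Site P j) (μ κ : Fin P.d) :
    x.unshift μ κ = x κ + (((if κ = μ then (-1 : ℤ) else 0 : ℤ)) : ZMod (P.sitesPerDir j)) := by
  unfold Site.unshift
  by_cases h : κ = μ
  · subst h; simp [sub_eq_add_neg]
  · simp [h]

/-- Net displacement of `k` forward steps `+e_μ`. [folklore] -/
theorem netDisp_replicate_fwd {n : ℕ} (k : ℕ) (μ κ : Fin n) :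
    T4Continuum.netDisp (List.replicate k (μ, true)) κ = if κ = μ then (k : ℤ) else 0 := by
  rw [netDisp_replicate]
  by_cases h : κ = μ
  · subst h; simp
  · simp [h, Ne.symm h]

/-- The staircase of a unit transverse offset is the single letter `+e_ν`. [folklore] -/
theorem stairWord_unit (σ : Equiv.Perm (Fin P.d)) (ν : Fin P.d) (n : Fin P.d → ℤ)
    (hn : ∀ κ, n κ = if κ = ν then 1 else 0) : stairWord σ n = [(ν, true)] := by
  rw [stairWord_eq_axisRun_of_forall_ne σ n ν (fun κ hκ => by rw [hn, if_neg hκ]), hn ν, if_pos rfl]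
  rfl

/-- The open word `Γ ∪ [x,x′] ∪ (−Γ′)` of the chosen loop: `+e_ν`, `L` steps `+e_μ`, `−e_ν`. [folklore] -/
theorem openWord_unit (L : ℕ) (μ ν : Fin P.d) (n : Fin P.d → ℤ) (hn : ∀ κ, n κ = if κ = ν then 1 else 0) :
    openWord L μ n 1 1 = (ν, true) :: (List.replicate L (μ, true) ++ [(ν, false)]) := by
  unfold openWord
  rw [stairWord_unit 1 ν n hn]
  rfl

variable {G : Type*} [GaugeGroup G]

/-- **FACTORISATION OF THE CHOSEN OPEN HOLONOMY**: `V = U⟨emb c₋, ν⟩ · (U⟨emb c₋ + e_ν, μ⟩ · rest)`, where `rest` is the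
transport along the remaining `L − 1` segment bonds and back along `−e_ν`. [folklore] -/
theorem openHol_unit (U : GaugeField P j G) (c : PBond P (j+1)) (r : Fin P.d → Fin P.L) (ν : Fin P.d)
    (hr : ∀ κ, off r κ = if κ = ν then 1 else 0) :
    openHol U c (r, 1, 1) = U ⟨emb c.src, ν⟩ * (U ⟨(emb c.src).shift ν, c.dir⟩ *
      holAt U (walk (((emb c.src).shift ν).shift c.dir) (List.replicate (P.L - 1) (c.dir, true) ++ [(ν, false)]))) := by
  unfold openHol
  rw [show ((r, (1 : Equiv.Perm (Fin P.d)), (1 : Equiv.Perm (Fin P.d))) : Idx P).1 = r from rfl,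
    show ((r, (1 : Equiv.Perm (Fin P.d)), (1 : Equiv.Perm (Fin P.d))) : Idx P).2.1 = 1 from rfl,
    show ((r, (1 : Equiv.Perm (Fin P.d)), (1 : Equiv.Perm (Fin P.d))) : Idx P).2.2 = 1 from rfl,
    openWord_unit P.L c.dir ν (off r) hr]
  have hL : P.L = (P.L - 1) + 1 := by have := P.L_pos; omega
  conv_lhs => rw [hL, List.replicate_succ]
  simp only [walk, List.cons_append, holAt_cons, if_true]

end Words

/-! ## §2 Where the bonds of the chosen loops and of the axis lines can be -/

section Bonds

variable {P : Params} {j : ℕ}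

/-- The arithmetic engine: two presentations `emb y κ + r = emb y′ κ + r′` of one coordinate force `L ∣ r′ − r`, which is
absurd for `0 < |r′ − r| < L`. [folklore] -/
theorem false_of_emb_add_eq (hj : j + 1 ≤ P.m + P.K) {y y' : Site P (j+1)} {κ : Fin P.d} {r r' : ℤ}
    (h : emb y κ + (r : ZMod (P.sitesPerDir j)) = emb y' κ + (r' : ZMod (P.sitesPerDir j)))
    (h1 : -(P.L : ℤ) < r' - r) (h2 : r' - r < P.L) (h3 : r' ≠ r) : False :=
  h3 (by have := eq_zero_of_L_dvd (L_dvd_of_emb_add_eq hj h) h1 h2; omega)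

/-- A bond based at a block centre is not a central crossing bond. [folklore] -/
theorem centre_ne_centralBond (hj : j + 1 ≤ P.m + P.K) (y : Site P (j+1)) (ν : Fin P.d) (c' : PBond P (j+1)) :
    (⟨emb y, ν⟩ : PBond P j) ≠ centralBond c' := by
  intro h
  have hL := two_mul_half_add_one P
  have hL1 := P.hL.2
  have hd : ν = c'.dir := congrArg PBond.dir h
  have hs := congrFun (congrArg PBond.src h) ν
  change emb y ν = lineSite c' ((P.L - 1) / 2) ν at hs
  have key : emb y ν + ((0 : ℤ) : ZMod (P.sitesPerDir j)) =
      emb c'.src ν + ((((P.L - 1) / 2 : ℕ) : ℤ) : ZMod (P.sitesPerDir j)) := by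
    rw [hs, lineSite_apply_int, if_pos hd]; push_cast; ring
  exact false_of_emb_add_eq hj key (by omega) (by omega) (by omega)

/-- A bond based at a block centre is not the private link of any coarse bond (`τ` fixed-point free). [folklore] -/
theorem centre_ne_link (hj : j + 1 ≤ P.m + P.K) (τ : Fin P.d → Fin P.d) (y : Site P (j+1))
    (ν : Fin P.d) (c' : PBond P (j+1)) :
    (⟨emb y, ν⟩ : PBond P j) ≠ ⟨(emb c'.src).shift (τ c'.dir), c'.dir⟩ := by
  intro h
  have hL1 := P.hL.2
  have hd : ν = c'.dir := congrArg PBond.dir h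
  have hs := congrFun (congrArg PBond.src h) (τ ν)
  change emb y (τ ν) = (emb c'.src).shift (τ c'.dir) (τ ν) at hs
  have key : emb y (τ ν) + ((0 : ℤ) : ZMod (P.sitesPerDir j)) = emb c'.src (τ ν) + ((1 : ℤ) : ZMod (P.sitesPerDir j)) := by
    rw [hs, shift_apply_int, ← hd, if_pos rfl]; push_cast; ring
  exact false_of_emb_add_eq hj key (by omega) (by omega) (by omega)

/-- A transversally shifted bond `⟨emb y + e_ν, μ⟩`, `ν ≠ μ`, is not a central crossing bond. [folklore] -/
theorem shift_ne_centralBond (hj : j + 1 ≤ P.m + P.K) (y : Site P (j+1)) {ν μ : Fin P.d} (hνμ : ν ≠ μ)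
    (c' : PBond P (j+1)) : (⟨(emb y).shift ν, μ⟩ : PBond P j) ≠ centralBond c' := by
  intro h
  have hL1 := P.hL.2
  have hd : μ = c'.dir := congrArg PBond.dir h
  have hs := congrFun (congrArg PBond.src h) ν
  change (emb y).shift ν ν = lineSite c' ((P.L - 1) / 2) ν at hs
  have key : emb y ν + ((1 : ℤ) : ZMod (P.sitesPerDir j)) = emb c'.src ν + ((0 : ℤ) : ZMod (P.sitesPerDir j)) := by
    rw [← shift_apply_int_pos (emb y) ν, hs, lineSite_apply_int, if_neg (by rw [← hd]; exact hνμ)]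
  exact false_of_emb_add_eq hj key (by omega) (by omega) (by omega)

/-- **The private links are private**: `⟨emb y + e_{τμ}, μ⟩ = ⟨emb y′ + e_{τμ′}, μ′⟩` forces `(y, μ) = (y′, μ′)`. [folklore] -/
theorem link_injective (hj : j + 1 ≤ P.m + P.K) (τ : Fin P.d → Fin P.d) :
    Injective (fun c : PBond P (j+1) => (⟨(emb c.src).shift (τ c.dir), c.dir⟩ : PBond P j)) := by
  intro c c' h
  obtain ⟨hs, hd⟩ := PBond.mk.inj h
  have hy : c.src = c'.src := by
    funext κ
    have hκ := congrFun hs κ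
    rw [shift_apply_int, shift_apply_int, ← hd] at hκ
    exact apply_eq_of_emb_add_eq hj hκ
  cases c; cases c'
  simp only at hd hy
  subst hd; subst hy; rfl

/-- The bonds of the remaining segment `⟨emb y + e_ν + e_μ + t e_μ, μ⟩`, `t < L − 1` (`ν ≠ μ`), are neither central crossing
bonds nor private links (`τ μ = ν`). [folklore] -/
theorem segment_ne (hj : j + 1 ≤ P.m + P.K) (τ : Fin P.d → Fin P.d) (y : Site P (j+1)) {ν μ : Fin P.d} (hνμ : ν ≠ μ)
    (hτ : τ μ = ν) {s : LStep P j}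
    (hs : s ∈ walk (((emb y).shift ν).shift μ) (List.replicate (P.L - 1) (μ, true))) (c' : PBond P (j+1)) :
    s.bond ≠ centralBond c' ∧ s.bond ≠ ⟨(emb c'.src).shift (τ c'.dir), c'.dir⟩ := by
  obtain ⟨hdir, -, t, ht, hsrc⟩ := mem_walk_replicate hs
  have hL1 := P.hL.2
  -- the source coordinates: `emb y κ + [κ = ν] + [κ = μ](1 + t)`
  have hsrc' : ∀ κ, s.bond.src κ = emb y κ +
      (((if κ = ν then (1 : ℤ) else 0) + (if κ = μ then (1 : ℤ) + t else 0) : ℤ) : ZMod (P.sitesPerDir j)) := by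
    intro κ
    rw [hsrc κ, shift_apply_int, shift_apply_int]
    push_cast
    by_cases h1 : κ = ν
    · subst h1; simp [hνμ]
    · by_cases h2 : κ = μ
      · subst h2; simp [h1]; ring
      · simp [h1, h2]
  constructor
  · intro h
    have hd : s.bond.dir = c'.dir := by rw [h]; rfl
    have key : emb c'.src ν + ((0 : ℤ) : ZMod (P.sitesPerDir j)) = emb y ν + ((1 : ℤ) : ZMod (P.sitesPerDir j)) := by
      have e1 := hsrc' ν
      rw [h, if_pos rfl, if_neg hνμ] at e1
      change lineSite c' ((P.L - 1) / 2) ν = _ at e1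
      rw [lineSite_apply_int, if_neg (by rw [← hd, hdir]; exact hνμ)] at e1
      rw [e1]; push_cast; ring
    exact false_of_emb_add_eq hj key (by omega) (by omega) (by omega)
  · intro h
    have hd : c'.dir = μ := by rw [← hdir, h]
    have key : emb c'.src μ + ((0 : ℤ) : ZMod (P.sitesPerDir j)) = emb y μ + (((1 + t : ℤ)) : ZMod (P.sitesPerDir j)) := by
      have e1 := hsrc' μ
      rw [h, if_neg hνμ.symm, if_pos rfl] at e1
      change (emb c'.src).shift (τ c'.dir) μ = _ at e1
      rw [shift_apply_int, hd, hτ, if_neg hνμ.symm] at e1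
      rw [e1]; push_cast; ring
    exact false_of_emb_add_eq hj key (by omega) (by omega) (by omega)

/-- The returning bond `⟨x′ − e_ν, ν⟩` (`x′` = end of the transported segment) is neither a central crossing bond nor a
private link. [folklore] -/
theorem return_ne (hj : j + 1 ≤ P.m + P.K) (τ : Fin P.d → Fin P.d) (y : Site P (j+1))
    {ν μ : Fin P.d} (hνμ : ν ≠ μ) {s : LStep P j}
    (hs : s ∈ walk (walkEnd (((emb y).shift ν).shift μ) (List.replicate (P.L - 1) (μ, true))) [(ν, false)])
    (c' : PBond P (j+1)) :
    s.bond ≠ centralBond c' ∧ s.bond ≠ ⟨(emb c'.src).shift (τ c'.dir), c'.dir⟩ := by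
  simp only [walk, List.mem_singleton] at hs
  subst hs
  have hL := two_mul_half_add_one P
  have hL1 := P.hL.2
  -- coordinates of the source `x′ − e_ν`: `emb y κ + [κ = μ] L`
  have hx : ∀ κ, ((walkEnd (((emb y).shift ν).shift μ) (List.replicate (P.L - 1) (μ, true))).unshift ν) κ =
      emb y κ + (((if κ = μ then (P.L : ℤ) else 0 : ℤ)) : ZMod (P.sitesPerDir j)) := by
    intro κ
    have hc : (((P.L - 1 : ℕ) : ℤ)) = (P.L : ℤ) - 1 := by have := P.L_pos; omega
    rw [unshift_apply_int, walkEnd_apply, netDisp_replicate_fwd, shift_apply_int, shift_apply_int, hc]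
    split_ifs with h1 h2 <;> first | (exact absurd (h1.symm.trans h2) hνμ) | (push_cast; ring)
  constructor
  · intro h
    have hd : ν = c'.dir := congrArg PBond.dir h
    have key : emb y ν + ((0 : ℤ) : ZMod (P.sitesPerDir j)) =
        emb c'.src ν + ((((P.L - 1) / 2 : ℕ) : ℤ) : ZMod (P.sitesPerDir j)) := by
      have e1 := congrFun (congrArg PBond.src h) ν
      change ((walkEnd _ _).unshift ν) ν = lineSite c' ((P.L - 1) / 2) ν at e1
      rw [hx ν, if_neg hνμ, lineSite_apply_int, if_pos hd] at e1
      exact e1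
    exact false_of_emb_add_eq hj key (by omega) (by omega) (by omega)
  · intro h
    have hd : ν = c'.dir := congrArg PBond.dir h
    have e1 := congrFun (congrArg PBond.src h) (τ ν)
    change ((walkEnd _ _).unshift ν) (τ ν) = (emb c'.src).shift (τ c'.dir) (τ ν) at e1
    rw [hx (τ ν), shift_apply_int, ← hd, if_pos rfl] at e1
    by_cases hm : τ ν = μ
    · rw [if_pos hm] at e1
      have h1 := L_dvd_of_emb_add_eq hj e1
      have h2 : (P.L : ℤ) ∣ 1 := by
        have := dvd_add h1 (dvd_refl (P.L : ℤ))
        simpa using this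
      have h3 := Int.eq_one_of_dvd_one (by omega) h2
      omega
    · rw [if_neg hm] at e1
      exact false_of_emb_add_eq hj e1 (by omega) (by omega) (by omega)

/-- The first-half line bonds of `c` (`t < (L−1)/2`) are neither central crossing bonds nor private links. [folklore] -/
theorem preLine_ne (hj : j + 1 ≤ P.m + P.K) (τ : Fin P.d → Fin P.d) (hτ : ∀ μ, τ μ ≠ μ) (c : PBond P (j+1))
    {s : LStep P j} (hs : s ∈ walk (emb c.src) (List.replicate ((P.L - 1) / 2) (c.dir, true))) (c' : PBond P (j+1)) :
    s.bond ≠ centralBond c' ∧ s.bond ≠ ⟨(emb c'.src).shift (τ c'.dir), c'.dir⟩ := by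
  obtain ⟨hdir, -, t, ht, hsrc⟩ := mem_walk_replicate hs
  have hL := two_mul_half_add_one P
  have hL1 := P.hL.2
  constructor
  · intro h
    have hd : c.dir = c'.dir := by rw [← hdir, h]; rfl
    have key : emb c'.src c.dir + ((((P.L - 1) / 2 : ℕ) : ℤ) : ZMod (P.sitesPerDir j)) =
        emb c.src c.dir + ((t : ℤ) : ZMod (P.sitesPerDir j)) := by
      have e1 := hsrc c.dir
      rw [h, if_pos rfl] at e1
      change lineSite c' ((P.L - 1) / 2) c.dir = _ at e1
      rw [lineSite_apply_int, ← hd, if_pos rfl] at e1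
      exact e1
    exact false_of_emb_add_eq hj key (by omega) (by omega) (by omega)
  · intro h
    have hd : c'.dir = c.dir := by rw [← hdir, h]
    have key : emb c'.src (τ c.dir) + ((1 : ℤ) : ZMod (P.sitesPerDir j)) =
        emb c.src (τ c.dir) + ((0 : ℤ) : ZMod (P.sitesPerDir j)) := by
      have e1 := hsrc (τ c.dir)
      rw [h, if_neg (hτ c.dir)] at e1
      change (emb c'.src).shift (τ c'.dir) (τ c.dir) = _ at e1
      rw [shift_apply_int, hd, if_pos rfl] at e1
      exact e1
    exact false_of_emb_add_eq hj key (by omega) (by omega) (by omega)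

/-- The second-half line bonds of `c` (`(L−1)/2 < t < L`) are neither central crossing bonds nor private links. [folklore] -/
theorem postLine_ne (hj : j + 1 ≤ P.m + P.K) (τ : Fin P.d → Fin P.d) (hτ : ∀ μ, τ μ ≠ μ) (c : PBond P (j+1))
    {s : LStep P j} (hs : s ∈ walk (lineSite c ((P.L - 1) / 2 + 1)) (List.replicate ((P.L - 1) / 2) (c.dir, true)))
    (c' : PBond P (j+1)) :
    s.bond ≠ centralBond c' ∧ s.bond ≠ ⟨(emb c'.src).shift (τ c'.dir), c'.dir⟩ := by
  obtain ⟨hdir, -, t, ht, hsrc⟩ := mem_walk_replicate hs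
  have hL := two_mul_half_add_one P
  have hL1 := P.hL.2
  -- the source coordinates: `emb c₋ κ + [κ = μ]((L−1)/2 + 1 + t)`
  have hsrc' : ∀ κ, s.bond.src κ = emb c.src κ +
      (((if κ = c.dir then (((P.L - 1) / 2 : ℕ) : ℤ) + 1 + t else 0 : ℤ)) : ZMod (P.sitesPerDir j)) := by
    intro κ
    rw [hsrc κ, lineSite_apply_int]
    push_cast
    by_cases h1 : κ = c.dir
    · subst h1; simp; ring
    · simp [h1]
  constructor
  · intro h
    have hd : c.dir = c'.dir := by rw [← hdir, h]; rfl
    have key : emb c'.src c.dir + ((((P.L - 1) / 2 : ℕ) : ℤ) : ZMod (P.sitesPerDir j)) =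
        emb c.src c.dir + (((((P.L - 1) / 2 : ℕ) : ℤ) + 1 + t : ℤ) : ZMod (P.sitesPerDir j)) := by
      have e1 := hsrc' c.dir
      rw [h, if_pos rfl] at e1
      change lineSite c' ((P.L - 1) / 2) c.dir = _ at e1
      rw [lineSite_apply_int, ← hd, if_pos rfl] at e1
      exact e1
    exact false_of_emb_add_eq hj key (by omega) (by omega) (by omega)
  · intro h
    have hd : c'.dir = c.dir := by rw [← hdir, h]
    have key : emb c'.src (τ c.dir) + ((1 : ℤ) : ZMod (P.sitesPerDir j)) =
        emb c.src (τ c.dir) + ((0 : ℤ) : ZMod (P.sitesPerDir j)) := by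
      have e1 := hsrc' (τ c.dir)
      rw [h, if_neg (hτ c.dir)] at e1
      change (emb c'.src).shift (τ c'.dir) (τ c.dir) = _ at e1
      rw [shift_apply_int, hd, if_pos rfl] at e1
      exact e1
    exact false_of_emb_add_eq hj key (by omega) (by omega) (by omega)

/-- A private link is not a central crossing bond. [folklore] -/
theorem link_ne_centralBond (hj : j + 1 ≤ P.m + P.K) (τ : Fin P.d → Fin P.d) (hτ : ∀ μ, τ μ ≠ μ)
    (c c' : PBond P (j+1)) : (⟨(emb c.src).shift (τ c.dir), c.dir⟩ : PBond P j) ≠ centralBond c' :=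
  shift_ne_centralBond hj c.src (hτ c.dir) c'

end Bonds

end Summit.QuantumFields.YangMills.Theorems.AveragingPrivateLinks
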